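import Literature.AlgebraicGeometry.Motives.IntegralModelSpecialFibrePointsOver
import Literature.AlgebraicGeometry.Morphisms.FiniteCoverPointsOverPullback
import Literature.RingTheory.Valuation.IntegralPointsSpecialisationCount
import HarnessLib

/-!
# Reduction of the generic geometric fibre of a finite flat cover of proper models: the fibre over `x` specialises onto the special
# fibre over `red x` with multiplicities ([SerreTate1968] §1; [Liu2002] §10.1.3; [Hartshorne1977] II.3, II.4.7; [StacksProject] 01I1, 04GG, 02M0)

Topic `Literature/AlgebraicGeometry/Motives`, namespace `Literature.AlgebraicGeometry.Motives.IntegralModel` (D1 currency).  THEOREMS only (no def,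
no instance, no notation, no named fact, no `sorry`).  Cell `hodgecm-mathlib` (D-0151), FLOOR 0, programme F0P5a, crux item stmt-HodgeConjecture-24832 —
the GEOMETRIC ASSEMBLY (rows (L2c)+(L3b) of the (S-γ2) step list «specialisation of geometric fibres of a finite flat cover under the D1 reduction
map», F0P5a LEAD WORDS #11/#12, MOD-PLAN rows L5.5a/b; desk `F0/P5a/S-gamma2-DESK.v0` §2 (G1)–(G5)).  It composes, by name, ★ p799183
(`IntegralModel.ncard_fibre_geomReductionMap_eq_ncard_specialisation`, `…ncard_fibre_eq_ncard_integralPoints`), ★ p800251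
(`Morphisms.card_points_specialising_eq`, `bijective_appTop_lift`), ★ p799830 (`Morphisms.bijective_ofHom_algHom`, `moduleFree_sections_pullback`),
★ p798923 (`ValuationSubring.exists_completeOrthogonalIdempotents_isLocalRing`) and ★ p800184 + its ring-map appendix (`ValuationSubring.card_algHom_residue_comp_eq(_length)(_of_ringHom)`,
`exists_corner_of_ringHom`, `card_algHom_eq_finrank`, `sum_finrank_corner_eq`).

DATA.  `K` a number field, `v` a finite place, `Ω = \overline{K_v}`, `R ⊆ Ω` its valuation ring (`closureValuationSubring`, residue field `κ(R)`),
`𝒮`, `𝒯` PROPER models of `X`, `T` over `𝓞ᵥ`, `π : 𝒯 ⟶ 𝒮` a model morphism with generic fibre `p : T ⟶ X` (`hπp`) whose underlying morphism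
`π.left` is FINITE (and FLAT where ranks are taken), `x ∈ X(Ω)` with integral extension `xt = extendPoint R f 𝒮 (e_𝒮⁻¹ x) : Spec R → 𝒮` (hypothesis
`hxt`, so that every statement is about a short variable `xt`), and the FIBRE ALGEBRA `B := Γ(pullback π.left xt.left, ⊤)` — a module-finite (free) `R`-algebra
through `φ := (ΓSpecIso R)⁻¹ ≫ snd.appTop` (any `Algebra R B` with `algebraMap = φ`, hypothesis `halg`).  A `κ(R)`-point `yκ` of `𝒯` over `ι_κ ≫ xt`
(`hyκ`; these ARE the points of the special fibre `𝒯_v` over `red_𝒮 x`, ★ `bijective_reductionPoint_fibre`) has the ring map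
`χ_yκ := (pullback.lift yκ.left (Spec κ(R) → Spec R) _).appTop ≫ (ΓSpecIso κ(R)).hom : B → κ(R)`.

* §1 `overHom_left_bijective(₂)`, `card_overHom_eq_card_left(₂)` — morphisms OVER a base with prescribed composites ↔ their underlying morphisms;
* §2 the dictionary, in D1 currency (sections ↔ algebra maps by ★ `Morphisms.card_under_id(_comp)_eq_card_algHom`, valid for ANY `Algebra R B` with
  `algebraMap = φ`; corners of ring maps `B → κ(R)` by ★ `ValuationSubring.exists_corner_of_ringHom` / `card_algHom_residue_comp_eq(_length)_of_ringHom`):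
  - `ncard_fibre_geomReductionMap_eq_card_ringHom` — **`#{y ∈ T(Ω) : p y = x, red_𝒯 y = reductionPoint yκ} = #{ψ : B ⟶ R : φ ≫ ψ = 𝟙, ψ ≫ residue = χ_yκ}`**;
  - `card_fibre_eq_card_ringHom` / `card_fibre_eq_card_algHom` / **`card_fibre_eq_finrank`** — `#{y ∈ T(Ω) : p y = x} = #{sections of φ} = #(B →ₐ[R] R)
    = rank_R B` (the last for `π.left` flat and `Ω ⊗_R B` reduced, i.e. `p` étale over `x`);
  - `ncard_fibre_geomReductionMap_eq_card_algHom` — the count with prescribed reduction `= #{g : B →ₐ[R] R : residue ∘ g = χ_yκ}`;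
  - `exists_corner_of_residueFieldPoint` + **`ncard_fibre_geomReductionMap_eq_finrank_corner` / `…_eq_length_corner`** — `= rank_R B_I = length (B_I ⧸ 𝔪 B_I)`,
    `B_I = B ⧸ (1 - e_I)` the local factor of `B` at the corner `I = I_{χ_yκ}`: **the number of points of the generic geometric fibre over `x` reducing to a
    given point of the special fibre is the multiplicity of that point in the special fibre** — the pointwise form of the multiset identity
    `red_* [p⁻¹(x)] = [𝒯_v ×_{𝒮_v} red(x)]`; `sum_finrank_corner_eq_card_fibre` is its total-degree check `Σ_I rank B_I = #p⁻¹(x)`.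

HC_CM is proved only modulo the 7 printed citations until rung 0 closes; this file is a generic leaf and changes no count (it is the D1-side input
the MOD road needs for `stub_C3`, not a closing of it).

## References
* [SerreTate1968] J.-P. Serre, J. Tate, *Good reduction of abelian varieties*, Ann. of Math. 88 (1968), §1 (reduction map on points of proper models).
* [Liu2002] Q. Liu, *Algebraic Geometry and Arithmetic Curves*, §10.1.3 (reduction of points; Cor. 10.1.38–Prop. 10.1.40).
* [Hartshorne1977] R. Hartshorne, *Algebraic Geometry*, II.3 (schemes and morphisms over `S`, Thm. 3.3 fibred products), II.4.7 (valuative criterion).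
* [StacksProject] The Stacks Project, Tags 01I1 (morphisms into affine schemes), 04GG (finite algebras over henselian local rings), 02M0 (length and rank).
* [AtiyahMacdonald1969] M. F. Atiyah, I. G. Macdonald, *Introduction to Commutative Algebra*, Ch. 2 p. 30 (algebra homomorphisms).
-/

set_option autoImplicit false

noncomputable section

open CategoryTheory CategoryTheory.Limits AlgebraicGeometry IsDedekindDomain IsDedekindDomain.HeightOneSpectrum
open scoped NumberField TensorProduct
open Literature.NumberTheory.EllipticCurves (genericFibre)
open Literature.NumberTheory.GaloisRepresentations (closureValuationSubring)
open Literature.NumberTheory.DiophantineGeometry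

/-! ### §1 Morphisms over a base with prescribed composites ↔ their underlying morphisms -/

namespace Literature.AlgebraicGeometry.Motives

section Over

variable {C : Type*} [Category C] {S : C} {U U' V W : Over S}

/-- **`S`-morphisms `ρ : U ⟶ V` with `ρ ≫ π = x` ARE the morphisms `r : U.left ⟶ V.left` with `r ≫ π.left = x.left`** (`ρ ↦ ρ.left` is a bijection:
an `S`-morphism is determined by its underlying morphism, and `r` is automatically over `S` since `x` and `π` are).
[cite: Hartshorne1977, II.3 (schemes over S and S-morphisms)] -/
theorem overHom_left_bijective (π : V ⟶ W) (x : U ⟶ W) :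
    Function.Bijective (fun ρ : {ρ : U ⟶ V // ρ ≫ π = x} =>
      (⟨ρ.1.left, by rw [← Over.comp_left, ρ.2]⟩ : {r : U.left ⟶ V.left // r ≫ π.left = x.left})) := by
  refine ⟨fun ρ ρ' h => Subtype.ext (Over.OverMorphism.ext (congrArg Subtype.val h)), fun r => ?_⟩
  have w : r.1 ≫ V.hom = U.hom := by rw [← Over.w π, ← Category.assoc, r.2, Over.w x]
  exact ⟨⟨Over.homMk r.1 w, Over.OverMorphism.ext r.2⟩, rfl⟩

/-- The same with a prescribed SPECIALISATION `ι ≫ ρ = y` along `ι : U' ⟶ U` (e.g. `ι = Spec κ(R) → Spec R`): `ρ ↦ ρ.left` is a bijection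
`{ρ : U ⟶ V // ρ ≫ π = x ∧ ι ≫ ρ = y} → {r // r ≫ π.left = x.left ∧ ι.left ≫ r = y.left}`. [cite: Hartshorne1977, II.3 (schemes over S and S-morphisms)] -/
theorem overHom_left_bijective₂ (π : V ⟶ W) (x : U ⟶ W) (ι : U' ⟶ U) (y : U' ⟶ V) :
    Function.Bijective (fun ρ : {ρ : U ⟶ V // ρ ≫ π = x ∧ ι ≫ ρ = y} =>
      (⟨ρ.1.left, by rw [← Over.comp_left, ρ.2.1], by rw [← Over.comp_left, ρ.2.2]⟩ :
        {r : U.left ⟶ V.left // r ≫ π.left = x.left ∧ ι.left ≫ r = y.left})) := by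
  refine ⟨fun ρ ρ' h => Subtype.ext (Over.OverMorphism.ext (congrArg Subtype.val h)), fun r => ?_⟩
  have w : r.1 ≫ V.hom = U.hom := by rw [← Over.w π, ← Category.assoc, r.2.1, Over.w x]
  exact ⟨⟨Over.homMk r.1 w, ⟨Over.OverMorphism.ext r.2.1, Over.OverMorphism.ext r.2.2⟩⟩, rfl⟩

/-- Cardinality form of `overHom_left_bijective`. [cite: Hartshorne1977, II.3 (schemes over S and S-morphisms)] -/
theorem card_overHom_eq_card_left (π : V ⟶ W) (x : U ⟶ W) :
    Nat.card {ρ : U ⟶ V // ρ ≫ π = x} = Nat.card {r : U.left ⟶ V.left // r ≫ π.left = x.left} :=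
  Nat.card_eq_of_bijective _ (overHom_left_bijective π x)

/-- Cardinality form of `overHom_left_bijective₂`. [cite: Hartshorne1977, II.3 (schemes over S and S-morphisms)] -/
theorem card_overHom_eq_card_left₂ (π : V ⟶ W) (x : U ⟶ W) (ι : U' ⟶ U) (y : U' ⟶ V) :
    Nat.card {ρ : U ⟶ V // ρ ≫ π = x ∧ ι ≫ ρ = y} = Nat.card {r : U.left ⟶ V.left // r ≫ π.left = x.left ∧ ι.left ≫ r = y.left} :=
  Nat.card_eq_of_bijective _ (overHom_left_bijective₂ π x ι y)

end Over

end Literature.AlgebraicGeometry.Motives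

/-! ### §2 The dictionary in D1 currency -/

namespace Literature.AlgebraicGeometry.Motives

namespace IntegralModel

variable {K : Type} [Field K] [NumberField K] {v : HeightOneSpectrum (𝓞 K)} {X T : SchemeOver K}
  (𝒮 : IntegralModel (valuationSubringAtPrime K v) K X) (𝒯 : IntegralModel (valuationSubringAtPrime K v) K T) (π : 𝒯.total ⟶ 𝒮.total)

/-- The underlying point of a `κ(R)`-point `yκ` of `𝒯` over `ι_κ ≫ xt` lies over `Spec (residue) ≫ xt.left`.
[cite: Hartshorne1977, II.3 (schemes over S and S-morphisms)] -/
theorem left_comp_left_eq_of_comp_eq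
    (xt : specValuationSubring (closureValuationSubring (v.adicCompletion K)) (toClosureValuationSubring v) ⟶ 𝒮.total)
    (yκ : residueFieldPoints 𝒯.total)
    (hyκ : yκ ≫ π = specRingHomι (closureValuationSubring (v.adicCompletion K)) (toClosureValuationSubring v)
      (IsLocalRing.residue (closureValuationSubring (v.adicCompletion K))) ≫ xt) :
    yκ.left ≫ π.left = Spec.map (CommRingCat.ofHom (IsLocalRing.residue (closureValuationSubring (v.adicCompletion K)))) ≫ xt.left :=
  congrArg Over.Hom.left hyκ

/-- **The ring map `χ_yκ : B → κ(R)` of a `κ(R)`-point over `xt` is UNDER `R`**: `φ ≫ χ_yκ = residue` (★ `comp_eq_specMap_iff`, ★ `lift_comp_snd`).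
[cite: StacksProject, Tag 01I1] -/
theorem comp_appTop_lift_eq [IsFinite π.left]
    (xt : specValuationSubring (closureValuationSubring (v.adicCompletion K)) (toClosureValuationSubring v) ⟶ 𝒮.total)
    (yκ : residueFieldPoints 𝒯.total)
    (h : yκ.left ≫ π.left = Spec.map (CommRingCat.ofHom (IsLocalRing.residue (closureValuationSubring (v.adicCompletion K)))) ≫ xt.left) :
    ((Scheme.ΓSpecIso (CommRingCat.of ↥(closureValuationSubring (v.adicCompletion K)))).inv ≫ (pullback.snd π.left xt.left).appTop) ≫
        ((pullback.lift yκ.left (Spec.map (CommRingCat.ofHom (IsLocalRing.residue (closureValuationSubring (v.adicCompletion K))))) h).appTop ≫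
          (Scheme.ΓSpecIso (CommRingCat.of (IsLocalRing.ResidueField ↥(closureValuationSubring (v.adicCompletion K))))).hom) =
      CommRingCat.ofHom (IsLocalRing.residue (closureValuationSubring (v.adicCompletion K))) := by
  rw [Category.assoc]
  exact (Literature.AlgebraicGeometry.Morphisms.comp_eq_specMap_iff (pullback.snd π.left xt.left) _ _).1
    (Literature.AlgebraicGeometry.Morphisms.lift_comp_snd π.left xt.left _ yκ.left h)

variable [IsProper 𝒮.total.hom] [IsProper 𝒯.total.hom]

/-- **Points over `x` with prescribed reduction = sections of the fibre algebra with prescribed residue.**  For a `κ(R)`-point `yκ` of `𝒯`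
over `ι_κ ≫ xt`: `#{y ∈ T(Ω) : p y = x, red_𝒯 y = reductionPoint yκ} = #{ψ : B ⟶ R : φ ≫ ψ = 𝟙, ψ ≫ residue = χ_yκ}` (★ p799183 → §1 → ★
`card_points_specialising_eq` with `h = 𝟙`, `u = residue`). [cite: SerreTate1968, §1] [cite: Liu2002, §10.1.3] [cite: StacksProject, Tag 01I1] -/
theorem ncard_fibre_geomReductionMap_eq_card_ringHom (p : T ⟶ X)
    (hπp : (genericFibre (valuationSubringAtPrime K v) K).map π ≫ 𝒮.genericIso'.hom = 𝒯.genericIso'.hom ≫ p) [IsFinite π.left]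
    (x : AlgPoints X (AlgebraicClosure (v.adicCompletion K)))
    (xt : specValuationSubring (closureValuationSubring (v.adicCompletion K)) (toClosureValuationSubring v) ⟶ 𝒮.total)
    (hxt : extendPoint (closureValuationSubring (v.adicCompletion K)) (toClosureValuationSubring v) 𝒮.total (𝒮.modelPointsEquiv.symm x) = xt)
    (yκ : residueFieldPoints 𝒯.total)
    (hyκ : yκ ≫ π = specRingHomι (closureValuationSubring (v.adicCompletion K)) (toClosureValuationSubring v) (IsLocalRing.residue (closureValuationSubring (v.adicCompletion K))) ≫ xt) :
    Set.ncard {y : AlgPoints T (AlgebraicClosure (v.adicCompletion K)) | AlgPoints.map p y = x ∧ 𝒯.geomReductionMap y = 𝒯.reductionPoint yκ} =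
      Nat.card {ψ : ((pullback π.left xt.left).presheaf.obj (Opposite.op ⊤)) ⟶ CommRingCat.of ↥(closureValuationSubring (v.adicCompletion K)) // ((Scheme.ΓSpecIso (CommRingCat.of ↥(closureValuationSubring (v.adicCompletion K)))).inv ≫ (pullback.snd π.left xt.left).appTop) ≫ ψ = 𝟙 _ ∧
        ψ ≫ CommRingCat.ofHom (IsLocalRing.residue (closureValuationSubring (v.adicCompletion K))) = ((pullback.lift yκ.left (Spec.map (CommRingCat.ofHom (IsLocalRing.residue (closureValuationSubring (v.adicCompletion K))))) (left_comp_left_eq_of_comp_eq 𝒮 𝒯 π xt yκ hyκ)).appTop ≫ (Scheme.ΓSpecIso (CommRingCat.of (IsLocalRing.ResidueField ↥(closureValuationSubring (v.adicCompletion K))))).hom)} := by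
  subst hxt
  have hr' : yκ.left ≫ π.left = Spec.map (𝟙 _ ≫ CommRingCat.ofHom (IsLocalRing.residue (closureValuationSubring (v.adicCompletion K)))) ≫ (extendPoint (closureValuationSubring (v.adicCompletion K)) (toClosureValuationSubring v) 𝒮.total (𝒮.modelPointsEquiv.symm x)).left := by
    rw [Category.id_comp]; exact left_comp_left_eq_of_comp_eq 𝒮 𝒯 π _ yκ hyκ
  have hlift : pullback.lift yκ.left (Spec.map (𝟙 _ ≫ CommRingCat.ofHom (IsLocalRing.residue (closureValuationSubring (v.adicCompletion K))))) hr' =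
      pullback.lift yκ.left (Spec.map (CommRingCat.ofHom (IsLocalRing.residue (closureValuationSubring (v.adicCompletion K))))) (left_comp_left_eq_of_comp_eq 𝒮 𝒯 π _ yκ hyκ) :=
    pullback.hom_ext (by simp only [pullback.lift_fst]) (by simp only [pullback.lift_snd, Category.id_comp])
  calc Set.ncard {y : AlgPoints T (AlgebraicClosure (v.adicCompletion K)) | AlgPoints.map p y = x ∧ 𝒯.geomReductionMap y = 𝒯.reductionPoint yκ}
      = Nat.card {ρ : specValuationSubring (closureValuationSubring (v.adicCompletion K)) (toClosureValuationSubring v) ⟶ 𝒯.total // ρ ≫ π = extendPoint (closureValuationSubring (v.adicCompletion K)) (toClosureValuationSubring v) 𝒮.total (𝒮.modelPointsEquiv.symm x) ∧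
          specRingHomι (closureValuationSubring (v.adicCompletion K)) (toClosureValuationSubring v) (IsLocalRing.residue (closureValuationSubring (v.adicCompletion K))) ≫ ρ = yκ} := by
        rw [ncard_fibre_geomReductionMap_eq_ncard_specialisation 𝒮 𝒯 π p hπp x yκ, ← Nat.card_coe_set_eq]; rfl
    _ = Nat.card {r : Spec (CommRingCat.of ↥(closureValuationSubring (v.adicCompletion K))) ⟶ 𝒯.total.left // r ≫ π.left = (extendPoint (closureValuationSubring (v.adicCompletion K)) (toClosureValuationSubring v) 𝒮.total (𝒮.modelPointsEquiv.symm x)).left ∧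
          Spec.map (CommRingCat.ofHom (IsLocalRing.residue (closureValuationSubring (v.adicCompletion K)))) ≫ r = yκ.left} :=
        card_overHom_eq_card_left₂ π _ _ yκ
    _ = Nat.card {r : Spec (CommRingCat.of ↥(closureValuationSubring (v.adicCompletion K))) ⟶ 𝒯.total.left // r ≫ π.left = Spec.map (𝟙 _) ≫ (extendPoint (closureValuationSubring (v.adicCompletion K)) (toClosureValuationSubring v) 𝒮.total (𝒮.modelPointsEquiv.symm x)).left ∧
          Spec.map (CommRingCat.ofHom (IsLocalRing.residue (closureValuationSubring (v.adicCompletion K)))) ≫ r = yκ.left} :=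
        Nat.card_congr (Equiv.subtypeEquivRight fun r => by rw [Spec.map_id, Category.id_comp])
    _ = _ := Literature.AlgebraicGeometry.Morphisms.card_points_specialising_eq π.left _ (𝟙 _)
          (CommRingCat.ofHom (IsLocalRing.residue (closureValuationSubring (v.adicCompletion K)))) yκ.left hr'
    _ = _ := Nat.card_congr (Equiv.subtypeEquivRight fun ψ => by
          constructor
          · rintro ⟨h1, h2⟩
            exact ⟨by rw [Category.assoc]; exact h1, h2.trans (congrArg (fun t => Scheme.Hom.appTop t ≫ _) hlift)⟩
          · rintro ⟨h1, h2⟩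
            exact ⟨by rw [← Category.assoc]; exact h1, h2.trans (congrArg (fun t => Scheme.Hom.appTop t ≫ _) hlift.symm)⟩)

/-- **Points over `x` = sections of the fibre algebra**: `#{y ∈ T(Ω) : p y = x} = #{ψ : B ⟶ R : φ ≫ ψ = 𝟙}` (★ `ncard_fibre_eq_ncard_integralPoints` → §1 →
★ `bijective_appTop_lift` with `h = 𝟙`). [cite: Hartshorne1977, II.4.7] [cite: Liu2002, §10.1.3] [cite: StacksProject, Tag 01I1] -/
theorem card_fibre_eq_card_ringHom (p : T ⟶ X)
    (hπp : (genericFibre (valuationSubringAtPrime K v) K).map π ≫ 𝒮.genericIso'.hom = 𝒯.genericIso'.hom ≫ p) [IsFinite π.left]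
    (x : AlgPoints X (AlgebraicClosure (v.adicCompletion K)))
    (xt : specValuationSubring (closureValuationSubring (v.adicCompletion K)) (toClosureValuationSubring v) ⟶ 𝒮.total)
    (hxt : extendPoint (closureValuationSubring (v.adicCompletion K)) (toClosureValuationSubring v) 𝒮.total (𝒮.modelPointsEquiv.symm x) = xt) :
    Nat.card {y : AlgPoints T (AlgebraicClosure (v.adicCompletion K)) // AlgPoints.map p y = x} =
      Nat.card {ψ : ((pullback π.left xt.left).presheaf.obj (Opposite.op ⊤)) ⟶ CommRingCat.of ↥(closureValuationSubring (v.adicCompletion K)) // ((Scheme.ΓSpecIso (CommRingCat.of ↥(closureValuationSubring (v.adicCompletion K)))).inv ≫ (pullback.snd π.left xt.left).appTop) ≫ ψ = 𝟙 _} := by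
  subst hxt
  calc Nat.card {y : AlgPoints T (AlgebraicClosure (v.adicCompletion K)) // AlgPoints.map p y = x}
      = Nat.card {ρ : specValuationSubring (closureValuationSubring (v.adicCompletion K)) (toClosureValuationSubring v) ⟶ 𝒯.total // ρ ≫ π = extendPoint (closureValuationSubring (v.adicCompletion K)) (toClosureValuationSubring v) 𝒮.total (𝒮.modelPointsEquiv.symm x)} :=
        ncard_fibre_eq_ncard_integralPoints 𝒮 𝒯 π p hπp x
    _ = Nat.card {r : Spec (CommRingCat.of ↥(closureValuationSubring (v.adicCompletion K))) ⟶ 𝒯.total.left // r ≫ π.left = (extendPoint (closureValuationSubring (v.adicCompletion K)) (toClosureValuationSubring v) 𝒮.total (𝒮.modelPointsEquiv.symm x)).left} :=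
        card_overHom_eq_card_left π _
    _ = Nat.card {r : Spec (CommRingCat.of ↥(closureValuationSubring (v.adicCompletion K))) ⟶ 𝒯.total.left // r ≫ π.left = Spec.map (𝟙 _) ≫ (extendPoint (closureValuationSubring (v.adicCompletion K)) (toClosureValuationSubring v) 𝒮.total (𝒮.modelPointsEquiv.symm x)).left} :=
        Nat.card_congr (Equiv.subtypeEquivRight fun r => by rw [Spec.map_id, Category.id_comp])
    _ = _ := Nat.card_eq_of_bijective _ (Literature.AlgebraicGeometry.Morphisms.bijective_appTop_lift π.left _ (𝟙 _))
    _ = _ := Nat.card_congr (Equiv.subtypeEquivRight fun ψ =>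
          ⟨fun h => by rw [Category.assoc]; exact h, fun h => by rw [← Category.assoc]; exact h⟩)

/-- `#{y ∈ T(Ω) : p y = x} = #(B →ₐ[R] R)` for any algebra structure on `B = Γ(pullback π.left xt.left, ⊤)` with structure map `φ` (★ `Morphisms.card_under_id_eq_card_algHom`).
[cite: Liu2002, §10.1.3] [cite: AtiyahMacdonald1969, Ch. 2 p. 30 (A-algebra homomorphisms)] -/
theorem card_fibre_eq_card_algHom (p : T ⟶ X)
    (hπp : (genericFibre (valuationSubringAtPrime K v) K).map π ≫ 𝒮.genericIso'.hom = 𝒯.genericIso'.hom ≫ p) [IsFinite π.left]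
    (x : AlgPoints X (AlgebraicClosure (v.adicCompletion K)))
    (xt : specValuationSubring (closureValuationSubring (v.adicCompletion K)) (toClosureValuationSubring v) ⟶ 𝒮.total)
    (hxt : extendPoint (closureValuationSubring (v.adicCompletion K)) (toClosureValuationSubring v) 𝒮.total (𝒮.modelPointsEquiv.symm x) = xt)
    [Algebra ↥(closureValuationSubring (v.adicCompletion K)) ((pullback π.left xt.left).presheaf.obj (Opposite.op ⊤))]
    (halg : algebraMap ↥(closureValuationSubring (v.adicCompletion K)) ((pullback π.left xt.left).presheaf.obj (Opposite.op ⊤)) = ((Scheme.ΓSpecIso (CommRingCat.of ↥(closureValuationSubring (v.adicCompletion K)))).inv ≫ (pullback.snd π.left xt.left).appTop).hom) :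
    Nat.card {y : AlgPoints T (AlgebraicClosure (v.adicCompletion K)) // AlgPoints.map p y = x} = Nat.card (((pullback π.left xt.left).presheaf.obj (Opposite.op ⊤)) →ₐ[↥(closureValuationSubring (v.adicCompletion K))] ↥(closureValuationSubring (v.adicCompletion K))) :=
  (card_fibre_eq_card_ringHom 𝒮 𝒯 π p hπp x xt hxt).trans (Literature.AlgebraicGeometry.Morphisms.card_under_id_eq_card_algHom _ halg)

/-- **`#{y ∈ T(Ω) : p y = x} = rank_R B`** when `π.left` is finite FLAT (so `B` is free, ★ `moduleFree_sections_pullback`) and the generic fibre algebra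
`Ω ⊗_R B` is REDUCED (`p` étale over `x`) — ★ `ValuationSubring.card_algHom_eq_finrank`. [cite: Liu2002, §10.1.3] [cite: StacksProject, Tag 02M0] -/
theorem card_fibre_eq_finrank (p : T ⟶ X)
    (hπp : (genericFibre (valuationSubringAtPrime K v) K).map π ≫ 𝒮.genericIso'.hom = 𝒯.genericIso'.hom ≫ p) [IsFinite π.left] [Flat π.left]
    (x : AlgPoints X (AlgebraicClosure (v.adicCompletion K)))
    (xt : specValuationSubring (closureValuationSubring (v.adicCompletion K)) (toClosureValuationSubring v) ⟶ 𝒮.total)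
    (hxt : extendPoint (closureValuationSubring (v.adicCompletion K)) (toClosureValuationSubring v) 𝒮.total (𝒮.modelPointsEquiv.symm x) = xt)
    [Algebra ↥(closureValuationSubring (v.adicCompletion K)) ((pullback π.left xt.left).presheaf.obj (Opposite.op ⊤))]
    (halg : algebraMap ↥(closureValuationSubring (v.adicCompletion K)) ((pullback π.left xt.left).presheaf.obj (Opposite.op ⊤)) = ((Scheme.ΓSpecIso (CommRingCat.of ↥(closureValuationSubring (v.adicCompletion K)))).inv ≫ (pullback.snd π.left xt.left).appTop).hom)
    [IsReduced (AlgebraicClosure (v.adicCompletion K) ⊗[↥(closureValuationSubring (v.adicCompletion K))] ((pullback π.left xt.left).presheaf.obj (Opposite.op ⊤)))] :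
    Nat.card {y : AlgPoints T (AlgebraicClosure (v.adicCompletion K)) // AlgPoints.map p y = x} = Module.finrank ↥(closureValuationSubring (v.adicCompletion K)) ((pullback π.left xt.left).presheaf.obj (Opposite.op ⊤)) := by
  rw [card_fibre_eq_card_algHom 𝒮 𝒯 π p hπp x xt hxt halg]
  have hinst : ‹Algebra ↥(closureValuationSubring (v.adicCompletion K)) ((pullback π.left xt.left).presheaf.obj (Opposite.op ⊤))› = ((Scheme.ΓSpecIso (CommRingCat.of ↥(closureValuationSubring (v.adicCompletion K)))).inv ≫ (pullback.snd π.left xt.left).appTop).hom.toAlgebra :=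
    Algebra.algebra_ext _ _ fun r => by rw [halg]; rfl
  subst hinst
  letI := ((Scheme.ΓSpecIso (CommRingCat.of ↥(closureValuationSubring (v.adicCompletion K)))).inv ≫ (pullback.snd π.left xt.left).appTop).hom.toAlgebra
  haveI : Module.Finite ↥(closureValuationSubring (v.adicCompletion K)) ((pullback π.left xt.left).presheaf.obj (Opposite.op ⊤)) := Literature.AlgebraicGeometry.Morphisms.moduleFinite_sections_pullback π.left xt.left
  haveI : Module.Free ↥(closureValuationSubring (v.adicCompletion K)) ((pullback π.left xt.left).presheaf.obj (Opposite.op ⊤)) := Literature.AlgebraicGeometry.Morphisms.moduleFree_sections_pullback π.left xt.left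
  exact ValuationSubring.card_algHom_eq_finrank (closureValuationSubring (v.adicCompletion K))

/-- The count with prescribed reduction in algebra-map currency: `#{y : p y = x, red_𝒯 y = reductionPoint yκ} = #{g : B →ₐ[R] R : residue ∘ g = χ_yκ}`
(★ `Morphisms.card_under_id_comp_eq_card_algHom`). [cite: SerreTate1968, §1] [cite: Liu2002, §10.1.3] -/
theorem ncard_fibre_geomReductionMap_eq_card_algHom (p : T ⟶ X)
    (hπp : (genericFibre (valuationSubringAtPrime K v) K).map π ≫ 𝒮.genericIso'.hom = 𝒯.genericIso'.hom ≫ p) [IsFinite π.left]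
    (x : AlgPoints X (AlgebraicClosure (v.adicCompletion K)))
    (xt : specValuationSubring (closureValuationSubring (v.adicCompletion K)) (toClosureValuationSubring v) ⟶ 𝒮.total)
    (hxt : extendPoint (closureValuationSubring (v.adicCompletion K)) (toClosureValuationSubring v) 𝒮.total (𝒮.modelPointsEquiv.symm x) = xt)
    [Algebra ↥(closureValuationSubring (v.adicCompletion K)) ((pullback π.left xt.left).presheaf.obj (Opposite.op ⊤))]
    (halg : algebraMap ↥(closureValuationSubring (v.adicCompletion K)) ((pullback π.left xt.left).presheaf.obj (Opposite.op ⊤)) = ((Scheme.ΓSpecIso (CommRingCat.of ↥(closureValuationSubring (v.adicCompletion K)))).inv ≫ (pullback.snd π.left xt.left).appTop).hom)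
    (yκ : residueFieldPoints 𝒯.total)
    (hyκ : yκ ≫ π = specRingHomι (closureValuationSubring (v.adicCompletion K)) (toClosureValuationSubring v) (IsLocalRing.residue (closureValuationSubring (v.adicCompletion K))) ≫ xt) :
    Set.ncard {y : AlgPoints T (AlgebraicClosure (v.adicCompletion K)) | AlgPoints.map p y = x ∧ 𝒯.geomReductionMap y = 𝒯.reductionPoint yκ} =
      Nat.card {g : ((pullback π.left xt.left).presheaf.obj (Opposite.op ⊤)) →ₐ[↥(closureValuationSubring (v.adicCompletion K))] ↥(closureValuationSubring (v.adicCompletion K)) //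
        (IsLocalRing.residue ↥(closureValuationSubring (v.adicCompletion K))).comp (g : ((pullback π.left xt.left).presheaf.obj (Opposite.op ⊤)) →+* ↥(closureValuationSubring (v.adicCompletion K))) = ((pullback.lift yκ.left (Spec.map (CommRingCat.ofHom (IsLocalRing.residue (closureValuationSubring (v.adicCompletion K))))) (left_comp_left_eq_of_comp_eq 𝒮 𝒯 π xt yκ hyκ)).appTop ≫ (Scheme.ΓSpecIso (CommRingCat.of (IsLocalRing.ResidueField ↥(closureValuationSubring (v.adicCompletion K))))).hom).hom} :=
  (ncard_fibre_geomReductionMap_eq_card_ringHom 𝒮 𝒯 π p hπp x xt hxt yκ hyκ).trans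
    (Literature.AlgebraicGeometry.Morphisms.card_under_id_comp_eq_card_algHom _ halg (IsLocalRing.residue _) _)

omit [IsProper 𝒮.total.hom] [IsProper 𝒯.total.hom] in
/-- **The corner of a point of the special fibre**: for a `κ(R)`-point `yκ` over `xt`, the fibre algebra `B` (module-finite over `R`, ★
`moduleFinite_sections_pullback`) carries a separating complete orthogonal family of idempotents `e` with local corners, indexed by the finitely many
maximal ideals of `B ⧸ 𝔪B`, and `ker χ_yκ` is the contraction of one of them, `I_yκ` (★ `ValuationSubring.exists_corner_of_ringHom`). [cite: StacksProject, Tag 04GG] -/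
theorem exists_corner_of_residueFieldPoint [IsFinite π.left]
    (xt : specValuationSubring (closureValuationSubring (v.adicCompletion K)) (toClosureValuationSubring v) ⟶ 𝒮.total)
    [Algebra ↥(closureValuationSubring (v.adicCompletion K)) ((pullback π.left xt.left).presheaf.obj (Opposite.op ⊤))]
    (halg : algebraMap ↥(closureValuationSubring (v.adicCompletion K)) ((pullback π.left xt.left).presheaf.obj (Opposite.op ⊤)) = ((Scheme.ΓSpecIso (CommRingCat.of ↥(closureValuationSubring (v.adicCompletion K)))).inv ≫ (pullback.snd π.left xt.left).appTop).hom)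
    (yκ : residueFieldPoints 𝒯.total)
    (hyκ : yκ ≫ π = specRingHomι (closureValuationSubring (v.adicCompletion K)) (toClosureValuationSubring v) (IsLocalRing.residue (closureValuationSubring (v.adicCompletion K))) ≫ xt) :
    ∃ (_ : Fintype (MaximalSpectrum (((pullback π.left xt.left).presheaf.obj (Opposite.op ⊤)) ⧸ (IsLocalRing.maximalIdeal ↥(closureValuationSubring (v.adicCompletion K))).map (algebraMap ↥(closureValuationSubring (v.adicCompletion K)) ((pullback π.left xt.left).presheaf.obj (Opposite.op ⊤))))))
      (e : (MaximalSpectrum (((pullback π.left xt.left).presheaf.obj (Opposite.op ⊤)) ⧸ (IsLocalRing.maximalIdeal ↥(closureValuationSubring (v.adicCompletion K))).map (algebraMap ↥(closureValuationSubring (v.adicCompletion K)) ((pullback π.left xt.left).presheaf.obj (Opposite.op ⊤))))) → ((pullback π.left xt.left).presheaf.obj (Opposite.op ⊤))) (I : (MaximalSpectrum (((pullback π.left xt.left).presheaf.obj (Opposite.op ⊤)) ⧸ (IsLocalRing.maximalIdeal ↥(closureValuationSubring (v.adicCompletion K))).map (algebraMap ↥(closureValuationSubring (v.adicCompletion K))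 ((pullback π.left xt.left).presheaf.obj (Opposite.op ⊤)))))),
      CompleteOrthogonalIdempotents e ∧ (∀ I, 1 - e I ∈ I.asIdeal.comap (Ideal.Quotient.mk _)) ∧
      (∀ I I', I ≠ I' → e I ∈ I'.asIdeal.comap (Ideal.Quotient.mk _)) ∧ (∀ I, IsLocalRing (((pullback π.left xt.left).presheaf.obj (Opposite.op ⊤)) ⧸ Ideal.span {1 - e I})) ∧
      RingHom.ker ((pullback.lift yκ.left (Spec.map (CommRingCat.ofHom (IsLocalRing.residue (closureValuationSubring (v.adicCompletion K))))) (left_comp_left_eq_of_comp_eq 𝒮 𝒯 π xt yκ hyκ)).appTop ≫ (Scheme.ΓSpecIso (CommRingCat.of (IsLocalRing.ResidueField ↥(closureValuationSubring (v.adicCompletion K))))).hom).hom = I.asIdeal.comap (Ideal.Quotient.mk _) := by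
  have hχκ := comp_appTop_lift_eq 𝒮 𝒯 π xt yκ (left_comp_left_eq_of_comp_eq 𝒮 𝒯 π xt yκ hyκ)
  have hinst : ‹Algebra ↥(closureValuationSubring (v.adicCompletion K)) ((pullback π.left xt.left).presheaf.obj (Opposite.op ⊤))› = ((Scheme.ΓSpecIso (CommRingCat.of ↥(closureValuationSubring (v.adicCompletion K)))).inv ≫ (pullback.snd π.left xt.left).appTop).hom.toAlgebra :=
    Algebra.algebra_ext _ _ fun r => by rw [halg]; rfl
  subst hinst
  letI := ((Scheme.ΓSpecIso (CommRingCat.of ↥(closureValuationSubring (v.adicCompletion K)))).inv ≫ (pullback.snd π.left xt.left).appTop).hom.toAlgebra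
  haveI : Module.Finite ↥(closureValuationSubring (v.adicCompletion K)) ((pullback π.left xt.left).presheaf.obj (Opposite.op ⊤)) := Literature.AlgebraicGeometry.Morphisms.moduleFinite_sections_pullback π.left xt.left
  exact ValuationSubring.exists_corner_of_ringHom (closureValuationSubring (v.adicCompletion K)) _ (congrArg CommRingCat.Hom.hom hχκ)

/-- **MAIN (rank form).  The number of points of the generic geometric fibre over `x` reducing to the point `reductionPoint yκ` of the special fibre is
the rank of the local factor of the fibre algebra at that point**: `#{y ∈ T(Ω) : p y = x, red_𝒯 y = reductionPoint yκ} = rank_R (B ⧸ (1 - e_I))` for the corner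
`I = I_yκ` (`ker χ_yκ = I.comap mk`) of any separating complete orthogonal family `e` (★ `ValuationSubring.card_algHom_residue_comp_eq_of_ringHom`; `π.left` finite flat, `Ω ⊗_R B` reduced).
[cite: SerreTate1968, §1] [cite: Liu2002, §10.1.3] [cite: StacksProject, Tag 04GG] -/
theorem ncard_fibre_geomReductionMap_eq_finrank_corner (p : T ⟶ X)
    (hπp : (genericFibre (valuationSubringAtPrime K v) K).map π ≫ 𝒮.genericIso'.hom = 𝒯.genericIso'.hom ≫ p) [IsFinite π.left] [Flat π.left]
    (x : AlgPoints X (AlgebraicClosure (v.adicCompletion K)))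
    (xt : specValuationSubring (closureValuationSubring (v.adicCompletion K)) (toClosureValuationSubring v) ⟶ 𝒮.total)
    (hxt : extendPoint (closureValuationSubring (v.adicCompletion K)) (toClosureValuationSubring v) 𝒮.total (𝒮.modelPointsEquiv.symm x) = xt)
    [Algebra ↥(closureValuationSubring (v.adicCompletion K)) ((pullback π.left xt.left).presheaf.obj (Opposite.op ⊤))]
    (halg : algebraMap ↥(closureValuationSubring (v.adicCompletion K)) ((pullback π.left xt.left).presheaf.obj (Opposite.op ⊤)) = ((Scheme.ΓSpecIso (CommRingCat.of ↥(closureValuationSubring (v.adicCompletion K)))).inv ≫ (pullback.snd π.left xt.left).appTop).hom)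
    [IsReduced (AlgebraicClosure (v.adicCompletion K) ⊗[↥(closureValuationSubring (v.adicCompletion K))] ((pullback π.left xt.left).presheaf.obj (Opposite.op ⊤)))]
    [Fintype (MaximalSpectrum (((pullback π.left xt.left).presheaf.obj (Opposite.op ⊤)) ⧸ (IsLocalRing.maximalIdeal ↥(closureValuationSubring (v.adicCompletion K))).map (algebraMap ↥(closureValuationSubring (v.adicCompletion K)) ((pullback π.left xt.left).presheaf.obj (Opposite.op ⊤)))))]
    (e : (MaximalSpectrum (((pullback π.left xt.left).presheaf.obj (Opposite.op ⊤)) ⧸ (IsLocalRing.maximalIdeal ↥(closureValuationSubring (v.adicCompletion K))).map (algebraMap ↥(closureValuationSubring (v.adicCompletion K)) ((pullback π.left xt.left).presheaf.obj (Opposite.op ⊤))))) → ((pullback π.left xt.left).presheaf.obj (Opposite.op ⊤))) (he : CompleteOrthogonalIdempotents e)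
    (hsep1 : ∀ I, 1 - e I ∈ I.asIdeal.comap (Ideal.Quotient.mk _)) (hsep0 : ∀ I I', I ≠ I' → e I ∈ I'.asIdeal.comap (Ideal.Quotient.mk _))
    (yκ : residueFieldPoints 𝒯.total)
    (hyκ : yκ ≫ π = specRingHomι (closureValuationSubring (v.adicCompletion K)) (toClosureValuationSubring v) (IsLocalRing.residue (closureValuationSubring (v.adicCompletion K))) ≫ xt)
    (I : (MaximalSpectrum (((pullback π.left xt.left).presheaf.obj (Opposite.op ⊤)) ⧸ (IsLocalRing.maximalIdeal ↥(closureValuationSubring (v.adicCompletion K))).map (algebraMap ↥(closureValuationSubring (v.adicCompletion K)) ((pullback π.left xt.left).presheaf.obj (Opposite.op ⊤)))))) (hI : RingHom.ker ((pullback.lift yκ.left (Spec.map (CommRingCat.ofHom (IsLocalRing.residue (closureValuationSubring (v.adicCompletion K))))) (left_comp_left_eq_of_comp_eq 𝒮 𝒯 π xt yκ hyκ)).appTop ≫ (Scheme.ΓSpecIso (CommRingCat.of (IsLocalRing.ResidueField ↥(closureValuationSubring (v.adicCompletion K))))).hom).hom = I.asIdeal.comap (Ideal.Quotient.mk _)) 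:
    Set.ncard {y : AlgPoints T (AlgebraicClosure (v.adicCompletion K)) | AlgPoints.map p y = x ∧ 𝒯.geomReductionMap y = 𝒯.reductionPoint yκ} =
      Module.finrank ↥(closureValuationSubring (v.adicCompletion K)) (((pullback π.left xt.left).presheaf.obj (Opposite.op ⊤)) ⧸ Ideal.span {1 - e I}) := by
  rw [ncard_fibre_geomReductionMap_eq_card_algHom 𝒮 𝒯 π p hπp x xt hxt halg yκ hyκ]
  have hχκ := comp_appTop_lift_eq 𝒮 𝒯 π xt yκ (left_comp_left_eq_of_comp_eq 𝒮 𝒯 π xt yκ hyκ)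
  have hinst : ‹Algebra ↥(closureValuationSubring (v.adicCompletion K)) ((pullback π.left xt.left).presheaf.obj (Opposite.op ⊤))› = ((Scheme.ΓSpecIso (CommRingCat.of ↥(closureValuationSubring (v.adicCompletion K)))).inv ≫ (pullback.snd π.left xt.left).appTop).hom.toAlgebra :=
    Algebra.algebra_ext _ _ fun r => by rw [halg]; rfl
  subst hinst
  letI := ((Scheme.ΓSpecIso (CommRingCat.of ↥(closureValuationSubring (v.adicCompletion K)))).inv ≫ (pullback.snd π.left xt.left).appTop).hom.toAlgebra
  haveI : Module.Finite ↥(closureValuationSubring (v.adicCompletion K)) ((pullback π.left xt.left).presheaf.obj (Opposite.op ⊤)) := Literature.AlgebraicGeometry.Morphisms.moduleFinite_sections_pullback π.left xt.left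
  haveI : Module.Free ↥(closureValuationSubring (v.adicCompletion K)) ((pullback π.left xt.left).presheaf.obj (Opposite.op ⊤)) := Literature.AlgebraicGeometry.Morphisms.moduleFree_sections_pullback π.left xt.left
  exact ValuationSubring.card_algHom_residue_comp_eq_of_ringHom (closureValuationSubring (v.adicCompletion K)) e he hsep1 hsep0 I _ (congrArg CommRingCat.Hom.hom hχκ) hI

/-- **MAIN (length form): … `= length (B_I ⧸ 𝔪 B_I)`, the MULTIPLICITY of the point in the special fibre `B ⧸ 𝔪B = Γ` of `𝒯_v ×_(𝒮_v) red(x)`** — the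
pointwise form of «the generic geometric fibre over `x` reduces onto the special fibre over `red x` with multiplicities» (★ `ValuationSubring.card_algHom_residue_comp_eq_length_of_ringHom`).
[cite: SerreTate1968, §1] [cite: Liu2002, §10.1.3] [cite: StacksProject, Tag 02M0] -/
theorem ncard_fibre_geomReductionMap_eq_length_corner (p : T ⟶ X)
    (hπp : (genericFibre (valuationSubringAtPrime K v) K).map π ≫ 𝒮.genericIso'.hom = 𝒯.genericIso'.hom ≫ p) [IsFinite π.left] [Flat π.left]
    (x : AlgPoints X (AlgebraicClosure (v.adicCompletion K)))
    (xt : specValuationSubring (closureValuationSubring (v.adicCompletion K)) (toClosureValuationSubring v) ⟶ 𝒮.total)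
    (hxt : extendPoint (closureValuationSubring (v.adicCompletion K)) (toClosureValuationSubring v) 𝒮.total (𝒮.modelPointsEquiv.symm x) = xt)
    [Algebra ↥(closureValuationSubring (v.adicCompletion K)) ((pullback π.left xt.left).presheaf.obj (Opposite.op ⊤))]
    (halg : algebraMap ↥(closureValuationSubring (v.adicCompletion K)) ((pullback π.left xt.left).presheaf.obj (Opposite.op ⊤)) = ((Scheme.ΓSpecIso (CommRingCat.of ↥(closureValuationSubring (v.adicCompletion K)))).inv ≫ (pullback.snd π.left xt.left).appTop).hom)
    [IsReduced (AlgebraicClosure (v.adicCompletion K) ⊗[↥(closureValuationSubring (v.adicCompletion K))] ((pullback π.left xt.left).presheaf.obj (Opposite.op ⊤)))]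
    [Fintype (MaximalSpectrum (((pullback π.left xt.left).presheaf.obj (Opposite.op ⊤)) ⧸ (IsLocalRing.maximalIdeal ↥(closureValuationSubring (v.adicCompletion K))).map (algebraMap ↥(closureValuationSubring (v.adicCompletion K)) ((pullback π.left xt.left).presheaf.obj (Opposite.op ⊤)))))]
    (e : (MaximalSpectrum (((pullback π.left xt.left).presheaf.obj (Opposite.op ⊤)) ⧸ (IsLocalRing.maximalIdeal ↥(closureValuationSubring (v.adicCompletion K))).map (algebraMap ↥(closureValuationSubring (v.adicCompletion K)) ((pullback π.left xt.left).presheaf.obj (Opposite.op ⊤))))) → ((pullback π.left xt.left).presheaf.obj (Opposite.op ⊤))) (he : CompleteOrthogonalIdempotents e)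
    (hsep1 : ∀ I, 1 - e I ∈ I.asIdeal.comap (Ideal.Quotient.mk _)) (hsep0 : ∀ I I', I ≠ I' → e I ∈ I'.asIdeal.comap (Ideal.Quotient.mk _))
    (hloc : ∀ I, IsLocalRing (((pullback π.left xt.left).presheaf.obj (Opposite.op ⊤)) ⧸ Ideal.span {1 - e I}))
    (yκ : residueFieldPoints 𝒯.total)
    (hyκ : yκ ≫ π = specRingHomι (closureValuationSubring (v.adicCompletion K)) (toClosureValuationSubring v) (IsLocalRing.residue (closureValuationSubring (v.adicCompletion K))) ≫ xt)
    (I : (MaximalSpectrum (((pullback π.left xt.left).presheaf.obj (Opposite.op ⊤)) ⧸ (IsLocalRing.maximalIdeal ↥(closureValuationSubring (v.adicCompletion K))).map (algebraMap ↥(closureValuationSubring (v.adicCompletion K)) ((pullback π.left xt.left).presheaf.obj (Opposite.op ⊤)))))) (hI : RingHom.ker ((pullback.lift yκ.left (Spec.map (CommRingCat.ofHom (IsLocalRing.residue (closureValuationSubring (v.adicCompletion K))))) (left_comp_left_eq_of_comp_eq 𝒮 𝒯 π xt yκ hyκ)).appTop ≫ (Scheme.ΓSpecIso (CommRingCat.of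 (IsLocalRing.ResidueField ↥(closureValuationSubring (v.adicCompletion K))))).hom).hom = I.asIdeal.comap (Ideal.Quotient.mk _)) :
    (Set.ncard {y : AlgPoints T (AlgebraicClosure (v.adicCompletion K)) | AlgPoints.map p y = x ∧ 𝒯.geomReductionMap y = 𝒯.reductionPoint yκ} : ℕ∞) =
      Module.length (((pullback π.left xt.left).presheaf.obj (Opposite.op ⊤)) ⧸ Ideal.span {1 - e I})
        ((((pullback π.left xt.left).presheaf.obj (Opposite.op ⊤)) ⧸ Ideal.span {1 - e I}) ⧸ (IsLocalRing.maximalIdeal ↥(closureValuationSubring (v.adicCompletion K))).map (algebraMap ↥(closureValuationSubring (v.adicCompletion K)) (((pullback π.left xt.left).presheaf.obj (Opposite.op ⊤)) ⧸ Ideal.span {1 - e I}))) := by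
  have h1 := ncard_fibre_geomReductionMap_eq_card_algHom 𝒮 𝒯 π p hπp x xt hxt halg yκ hyκ
  have hχκ := comp_appTop_lift_eq 𝒮 𝒯 π xt yκ (left_comp_left_eq_of_comp_eq 𝒮 𝒯 π xt yκ hyκ)
  have hinst : ‹Algebra ↥(closureValuationSubring (v.adicCompletion K)) ((pullback π.left xt.left).presheaf.obj (Opposite.op ⊤))› = ((Scheme.ΓSpecIso (CommRingCat.of ↥(closureValuationSubring (v.adicCompletion K)))).inv ≫ (pullback.snd π.left xt.left).appTop).hom.toAlgebra :=
    Algebra.algebra_ext _ _ fun r => by rw [halg]; rfl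
  subst hinst
  letI := ((Scheme.ΓSpecIso (CommRingCat.of ↥(closureValuationSubring (v.adicCompletion K)))).inv ≫ (pullback.snd π.left xt.left).appTop).hom.toAlgebra
  haveI : Module.Finite ↥(closureValuationSubring (v.adicCompletion K)) ((pullback π.left xt.left).presheaf.obj (Opposite.op ⊤)) := Literature.AlgebraicGeometry.Morphisms.moduleFinite_sections_pullback π.left xt.left
  haveI : Module.Free ↥(closureValuationSubring (v.adicCompletion K)) ((pullback π.left xt.left).presheaf.obj (Opposite.op ⊤)) := Literature.AlgebraicGeometry.Morphisms.moduleFree_sections_pullback π.left xt.left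
  exact (congrArg (Nat.cast : ℕ → ℕ∞) h1).trans
    (ValuationSubring.card_algHom_residue_comp_eq_length_of_ringHom (closureValuationSubring (v.adicCompletion K)) e he hsep1 hsep0 hloc
      I _ (congrArg CommRingCat.Hom.hom hχκ) hI)

/-- Total-degree check of the multiset identity: `Σ_I rank_R (B ⧸ (1 - e_I)) = #{y ∈ T(Ω) : p y = x}` (★ `sum_finrank_corner_eq` + `card_fibre_eq_finrank`).
[cite: Liu2002, §10.1.3] [cite: StacksProject, Tag 02M0] -/
theorem sum_finrank_corner_eq_card_fibre (p : T ⟶ X)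
    (hπp : (genericFibre (valuationSubringAtPrime K v) K).map π ≫ 𝒮.genericIso'.hom = 𝒯.genericIso'.hom ≫ p) [IsFinite π.left] [Flat π.left]
    (x : AlgPoints X (AlgebraicClosure (v.adicCompletion K)))
    (xt : specValuationSubring (closureValuationSubring (v.adicCompletion K)) (toClosureValuationSubring v) ⟶ 𝒮.total)
    (hxt : extendPoint (closureValuationSubring (v.adicCompletion K)) (toClosureValuationSubring v) 𝒮.total (𝒮.modelPointsEquiv.symm x) = xt)
    [Algebra ↥(closureValuationSubring (v.adicCompletion K)) ((pullback π.left xt.left).presheaf.obj (Opposite.op ⊤))]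
    (halg : algebraMap ↥(closureValuationSubring (v.adicCompletion K)) ((pullback π.left xt.left).presheaf.obj (Opposite.op ⊤)) = ((Scheme.ΓSpecIso (CommRingCat.of ↥(closureValuationSubring (v.adicCompletion K)))).inv ≫ (pullback.snd π.left xt.left).appTop).hom)
    [IsReduced (AlgebraicClosure (v.adicCompletion K) ⊗[↥(closureValuationSubring (v.adicCompletion K))] ((pullback π.left xt.left).presheaf.obj (Opposite.op ⊤)))]
    [Fintype (MaximalSpectrum (((pullback π.left xt.left).presheaf.obj (Opposite.op ⊤)) ⧸ (IsLocalRing.maximalIdeal ↥(closureValuationSubring (v.adicCompletion K))).map (algebraMap ↥(closureValuationSubring (v.adicCompletion K)) ((pullback π.left xt.left).presheaf.obj (Opposite.op ⊤)))))]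
    (e : (MaximalSpectrum (((pullback π.left xt.left).presheaf.obj (Opposite.op ⊤)) ⧸ (IsLocalRing.maximalIdeal ↥(closureValuationSubring (v.adicCompletion K))).map (algebraMap ↥(closureValuationSubring (v.adicCompletion K)) ((pullback π.left xt.left).presheaf.obj (Opposite.op ⊤))))) → ((pullback π.left xt.left).presheaf.obj (Opposite.op ⊤))) (he : CompleteOrthogonalIdempotents e) :
    ∑ I, Module.finrank ↥(closureValuationSubring (v.adicCompletion K)) (((pullback π.left xt.left).presheaf.obj (Opposite.op ⊤)) ⧸ Ideal.span {1 - e I}) = Nat.card {y : AlgPoints T (AlgebraicClosure (v.adicCompletion K)) // AlgPoints.map p y = x} := by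
  have hinst : ‹Algebra ↥(closureValuationSubring (v.adicCompletion K)) ((pullback π.left xt.left).presheaf.obj (Opposite.op ⊤))› = ((Scheme.ΓSpecIso (CommRingCat.of ↥(closureValuationSubring (v.adicCompletion K)))).inv ≫ (pullback.snd π.left xt.left).appTop).hom.toAlgebra :=
    Algebra.algebra_ext _ _ fun r => by rw [halg]; rfl
  subst hinst
  letI := ((Scheme.ΓSpecIso (CommRingCat.of ↥(closureValuationSubring (v.adicCompletion K)))).inv ≫ (pullback.snd π.left xt.left).appTop).hom.toAlgebra
  haveI : Module.Finite ↥(closureValuationSubring (v.adicCompletion K)) ((pullback π.left xt.left).presheaf.obj (Opposite.op ⊤)) := Literature.AlgebraicGeometry.Morphisms.moduleFinite_sections_pullback π.left xt.left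
  haveI : Module.Free ↥(closureValuationSubring (v.adicCompletion K)) ((pullback π.left xt.left).presheaf.obj (Opposite.op ⊤)) := Literature.AlgebraicGeometry.Morphisms.moduleFree_sections_pullback π.left xt.left
  exact (ValuationSubring.sum_finrank_corner_eq (closureValuationSubring (v.adicCompletion K)) e he).trans
    (card_fibre_eq_finrank 𝒮 𝒯 π p hπp x xt hxt halg).symm

end IntegralModel

end Literature.AlgebraicGeometry.Motives

end
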